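import Mathlib.MeasureTheory.Measure.Haar.Unique
import Literature.Analysis.FunctionSpaces.SobolevTrace
import Literature.Analysis.FunctionSpaces.MorreyInequality
import Literature.Analysis.FunctionSpaces.Mollification
import HarnessLib

/-!
# Discharged facts: Morrey's embedding `W^{1,p}(ℝⁿ) ⊂ C^{0,1-n/p}_b(ℝⁿ)` (`SobolevTrace`)

`Literature.Analysis.FunctionSpaces.SobolevTrace` states Morrey's embedding on the whole space
as the named fact `Literature.Analysis.FunctionSpaces.morrey_embedding` (L. C. Evans, *Partial Differential Equations*, 2nd ed.
(2010), §5.6.2, Theorem 4 (Morrey's inequality) and Theorem 5 (estimates for `W^{1,p}`,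
`n < p ≤ ∞`), with the Remark after Theorem 5: for `n < p < ∞` every `u ∈ W^{1,p}(ℝⁿ)` has a
version `u* = u` a.e. which is bounded and Hölder continuous of exponent `γ = 1 - n/p`;
R. A. Adams, *Sobolev Spaces* (1975), Thm. 5.4, Part I Case C and Part II Case C' with
`m = 1`, `j = 0`, `Ω = ℝⁿ`). This file proves it:

* `Literature.morrey_embedding_holds : morrey_embedding`.

## Proof (Evans, §5.6.2, proof of Theorem 5 for `U = ℝⁿ`; Adams, Lemma 5.17 and Thm. 3.16)

Let `n = dim E ≥ 1` (in dimension `0` the space is a point and `f` itself is the representative)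
and `f ∈ W^{1,p}(E)`, `n < p < ∞`, with weak derivative `g ∈ L^p` (`memLp_clm_of_forall_apply`
assembles `g ∈ L^p(E; E →L F)` from its components along a basis). Mollify:
`u_k = φ_k ⋆ f` for a bump sequence `φ_k` (`Literature.Analysis.FunctionSpaces.exists_contDiffBump_seq`). By the accepted
`Mollification` file, `u_k` is `C¹` with `D u_k = φ_k ⋆ g`
(`HasWeakFDerivOn.hasFDerivAt_convolution`, Evans §5.3.1 Thm. 1), `‖u_k‖_p ≤ ‖f‖_p`,
`‖D u_k‖_p ≤ ‖g‖_p` (Young), and `u_k → f` a.e. (Lebesgue differentiation). Morrey's inequality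
for `C¹` maps (`Literature.Analysis.FunctionSpaces.morrey_holder`, `Literature.Analysis.FunctionSpaces.morrey_sup` of `MorreyInequality`, Evans Thm. 4; Adams
Lemmas 5.15, 5.17) makes the family `u_k` uniformly bounded by `M = C (‖f‖_p + ‖g‖_p)` and
uniformly `γ`-Hölder with constant `C ‖g‖_p`, `γ = 1 - n/p`. The convergence set is of full
measure, hence dense (`Measure.dense_of_ae`), so `(u_k x)_k` is Cauchy for *every* `x` (an
`ε/3` argument), and its pointwise limit `G` is a version of `f` inheriting both bounds; thus
`G ∈ C^{0,γ}_b` (`Literature.Analysis.FunctionSpaces.MemBoundedHolder`). This is Evans's passage from Theorem 4 to Theorem 5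
(smooth `u_m → u`, the `u_m` converge to a version `u*` of `u` which satisfies the estimate;
Evans obtains the convergence from `(u_m)` being Cauchy in `W^{1,p}` and the linearity of the
estimate, Adams (proof of Lemma 5.15) likewise from Thm. 3.16; here it is obtained from
equi-Hölder continuity and a.e. convergence, which avoids norm convergence of mollifications).
A general additive Haar measure `μ` is a positive finite multiple of Lebesgue measure
(`Measure.isAddLeftInvariant_eq_smul`), under which `W^{1,p}` is invariant
(`MemSobolevDomain.smul_measure`), and `μ ≪ volume` transfers the a.e. equality.

## Mathlib search

Mathlib (this pin) has no Morrey inequality / embedding (`lean search 'Morrey'`: only this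
library's `MorreyInequality`, `SobolevImbeddingSup`) and no weak derivatives; the ingredients used
are `Module.Basis.exists_opNorm_le`, `Measure.dense_of_ae`, `CauchySeq.tendsto_limUnder`,
`HolderWith.eHolderNorm_le` and the Haar uniqueness `Measure.isAddLeftInvariant_eq_smul`.

## References

* L. C. Evans, *Partial Differential Equations*, 2nd ed., AMS GSM 19 (2010), §5.6.2,
  Theorems 4–5 and Remark; §5.3.1 Theorem 1; App. C.4 Theorem 7.
* R. A. Adams, *Sobolev Spaces*, Academic Press (1975), Lemma 5.17, Thm. 5.4.
-/

noncomputable section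

open MeasureTheory TopologicalSpace Metric Set Filter Topology Module ContinuousLinearMap
open scoped ENNReal NNReal ContDiff Convolution

namespace Literature.Analysis.FunctionSpaces

/-! ### Two measure-theoretic preliminaries -/

section Prelim

variable {E' : Type*} [NormedAddCommGroup E'] [NormedSpace ℝ E'] [MeasurableSpace E']
variable {F : Type*} [NormedAddCommGroup F] [NormedSpace ℝ F]

/-- A map into `E' →L[ℝ] F`, `E'` finite-dimensional, all of whose evaluations `x ↦ G x v` are
in `L^p` is itself in `L^p` (operator norm): `‖G x‖ ≤ C Σᵢ ‖G x eᵢ‖` for a basis `(eᵢ)`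
(`Module.Basis.exists_opNorm_le`). Used to see that the bundled weak derivative of a `W^{1,p}`
function is in `L^p`. [folklore] -/
theorem memLp_clm_of_forall_apply [FiniteDimensional ℝ E'] {μ : Measure E'}
    {G : E' → E' →L[ℝ] F} {p : ℝ≥0∞} (hG : AEStronglyMeasurable G μ)
    (h : ∀ v, MemLp (fun x => G x v) p μ) : MemLp G p μ := by
  set b := Module.finBasis ℝ E'
  obtain ⟨C, -, hC⟩ := b.exists_opNorm_le (F := F)
  have hS : MemLp (fun x => ∑ i, ‖G x (b i)‖) p μ :=
    memLp_finsetSum Finset.univ fun i _ => (h (b i)).norm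
  refine hS.of_le_mul (c := C) hG (Eventually.of_forall fun x => ?_)
  have h0 : 0 ≤ ∑ i, ‖G x (b i)‖ := Finset.sum_nonneg fun i _ => norm_nonneg _
  rw [Real.norm_of_nonneg h0]
  exact hC h0 fun i =>
    Finset.single_le_sum (fun j _ => norm_nonneg (G x (b j))) (Finset.mem_univ i)

/-- Local integrability on a set is preserved under multiplying the measure by a finite
constant. [folklore] -/
theorem locallyIntegrableOn_smul_measure {X G' : Type*} [TopologicalSpace X] [MeasurableSpace X]
    [NormedAddCommGroup G'] {u : X → G'} {s : Set X} {μ : Measure X}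
    (hu : LocallyIntegrableOn u s μ) {c : ℝ≥0∞} (hc : c ≠ ⊤) :
    LocallyIntegrableOn u s (c • μ) := fun x hx => by
  obtain ⟨t, ht, hint⟩ := hu x hx
  refine ⟨t, ht, ?_⟩
  rw [IntegrableOn, Measure.restrict_smul]
  exact hint.smul_measure hc

/-- Weak derivatives are unchanged when the measure is multiplied by a finite constant (both
sides of the integration-by-parts identity scale by `c`). [folklore] -/
theorem HasWeakFDerivOn.smul_measure {Ω : Opens E'} {μ : Measure E'} {f : E' → F}
    {g : E' → E' →L[ℝ] F} (h : HasWeakFDerivOn Ω μ f g) {c : ℝ≥0∞} (hc : c ≠ ⊤) :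
    HasWeakFDerivOn Ω (c • μ) f g := by
  refine ⟨locallyIntegrableOn_smul_measure h.locallyIntegrableOn hc,
    locallyIntegrableOn_smul_measure h.locallyIntegrableOn_deriv hc, fun φ v hφ => ?_⟩
  rw [Measure.restrict_smul, integral_smul_measure, integral_smul_measure,
    h.integral_fderiv_smul_eq φ v hφ, smul_neg]

/-- Membership in `W^{k,p}(Ω)` is unchanged when the measure is multiplied by a finite constant
(`L^p` classes and weak derivatives are). [folklore] -/
theorem MemSobolevDomain.smul_measure {k : ℕ} {p : ℝ≥0∞} {Ω : Opens E'} {μ : Measure E'}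
    {f : E' → F} (hf : MemSobolevDomain k p Ω μ f) {c : ℝ≥0∞} (hc : c ≠ ⊤) :
    MemSobolevDomain k p Ω (c • μ) f := by
  induction k generalizing f with
  | zero =>
    rw [memSobolevDomain_zero_iff] at hf ⊢
    rw [Measure.restrict_smul]
    exact hf.smul_measure hc
  | succ k ih =>
    obtain ⟨hf0, g, hg, hgk⟩ := hf
    refine ⟨?_, g, hg.smul_measure hc, fun v => ih (hgk v)⟩
    rw [Measure.restrict_smul]
    exact hf0.smul_measure hc

end Prelim

/-! ### Morrey's embedding for Lebesgue measure -/

variable {E : Type*} [NormedAddCommGroup E] [InnerProductSpace ℝ E] [FiniteDimensional ℝ E]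
  [MeasurableSpace E] [BorelSpace E]
variable {F : Type*} [NormedAddCommGroup F] [NormedSpace ℝ F] [CompleteSpace F]

/-- **Morrey's embedding on the whole space, Lebesgue measure** (Evans, *PDE*, 2nd ed., §5.6.2,
Theorems 4–5, case `n < p < ∞`, `U = ℝⁿ`; Adams, *Sobolev Spaces* (1975), Thm. 5.4, Part I
Case C (8) `W^{m,p}(Ω) → C_B^0(Ω)` and Part II Case C' (9) `W^{m,p}(Ω) → C^{0,λ}(Ω̄)`,
`0 < λ ≤ m - n/p`, with `m = 1`, `j = 0`, `Ω = ℝⁿ`): for `n = dim E < p < ∞`, every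
`f ∈ W^{1,p}(E)` has a version `g = f` a.e. which is bounded and Hölder continuous of exponent
`1 - n/p`. (In dimension `n = 0`, outside the printed hypotheses, the claim is trivial and
included.) Proof by mollification from Morrey's inequality for `C¹` maps (`morrey_holder`,
`morrey_sup`), see the module docstring. [cite: Evans2010, §5.6.2 Theorems 4–5] [cite: Adams1975, Thm. 5.4 Part I Case C and Part II Case C' (m = 1, j = 0)] -/
theorem exists_memBoundedHolder_of_memSobolevDomain {p : ℝ≥0∞}
    (hp : (finrank ℝ E : ℝ) < p.toReal) (hp' : p ≠ ⊤) {f : E → F}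
    (hf : MemSobolevDomain 1 p ⊤ (volume : Measure E) f) :
    ∃ g : E → F, g =ᵐ[(volume : Measure E)] f ∧
      MemBoundedHolder (Real.toNNReal (1 - finrank ℝ E / p.toReal)) g := by
  rcases subsingleton_or_nontrivial E with hE | hE
  · -- dimension `0`: `E` is a point and `f` itself is bounded and Hölder
    refine ⟨f, EventuallyEq.rfl, memBoundedHolder_iff.2 ⟨⟨‖f 0‖, fun x => ?_⟩, 0, fun x y => ?_⟩⟩
    · rw [Subsingleton.elim x 0]
    · rw [Subsingleton.elim x y, edist_self]; exact zero_le
  -- positive dimension; `p = q < ∞`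
  obtain ⟨q, rfl⟩ : ∃ q : ℝ≥0, p = q := ⟨p.toNNReal, (ENNReal.coe_toNNReal hp').symm⟩
  simp only [ENNReal.coe_toReal] at hp ⊢
  set n := finrank ℝ E with hn
  have hn1 : 1 ≤ n := Module.finrank_pos
  have hq1 : 1 ≤ q := by
    have : (1 : ℝ) ≤ q := le_trans (by exact_mod_cast hn1) hp.le
    exact_mod_cast this
  have hq1' : (1 : ℝ≥0∞) ≤ q := by exact_mod_cast hq1
  have hq0 : (0 : ℝ) < q := by exact_mod_cast (lt_of_lt_of_le zero_lt_one hq1)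
  -- the Hölder exponent
  set r : ℝ≥0 := Real.toNNReal (1 - n / (q : ℝ)) with hr
  have hγ0 : 0 < 1 - (n : ℝ) / q := by rw [sub_pos, div_lt_one hq0]; exact hp
  have hrγ : ((r : ℝ≥0) : ℝ) = 1 - (n : ℝ) / q := Real.coe_toNNReal _ hγ0.le
  have hr0 : (0 : ℝ) < r := by rw [hrγ]; exact hγ0
  -- unpack `f ∈ W^{1,p}`: `f ∈ L^p` with weak derivative `g ∈ L^p`
  obtain ⟨hfp, g, hfg, hgv⟩ := hf
  simp only [Opens.coe_top, Measure.restrict_univ] at hfp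
  have hf_li : LocallyIntegrable f volume :=
    locallyIntegrableOn_univ.1 (by simpa only [Opens.coe_top] using hfg.locallyIntegrableOn)
  have hg_li : LocallyIntegrable g volume :=
    locallyIntegrableOn_univ.1 (by simpa only [Opens.coe_top] using hfg.locallyIntegrableOn_deriv)
  have hgp : MemLp g q volume :=
    memLp_clm_of_forall_apply hg_li.aestronglyMeasurable fun v => by
      simpa only [memSobolevDomain_zero_iff, Opens.coe_top, Measure.restrict_univ] using hgv v
  -- mollification `u k = φ k ⋆ f`
  obtain ⟨φ, hφ0, hφ2⟩ := exists_contDiffBump_seq (E := E)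
  set u : ℕ → E → F := fun k => (φ k).normed volume ⋆[lsmul ℝ ℝ, volume] f with hu
  have hu1 : ∀ k, ContDiff ℝ 1 (u k) := fun k =>
    hfg.contDiff_convolution (isTestFunctionOn_normed (φ k))
  have hDu : ∀ k, fderiv ℝ (u k) = (φ k).normed volume ⋆[lsmul ℝ ℝ, volume] g := fun k =>
    funext fun x => (hfg.hasFDerivAt_convolution (isTestFunctionOn_normed (φ k)) x).fderiv
  set Nf := eLpNorm f q volume with hNf_def
  set Ng := eLpNorm g q volume with hNg_def
  have hNf : Nf < ⊤ := hfp.eLpNorm_lt_top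
  have hNg : Ng < ⊤ := hgp.eLpNorm_lt_top
  have hu0 : ∀ k, eLpNorm (u k) q volume ≤ Nf := fun k =>
    eLpNorm_normed_convolution_le (φ k) hfp.aestronglyMeasurable hq1'
  have hDu' : ∀ k, eLpNorm (fderiv ℝ (u k)) q volume ≤ Ng := fun k => by
    rw [hDu k]
    exact eLpNorm_normed_convolution_le (φ k) hgp.aestronglyMeasurable hq1'
  -- Morrey's inequality for the `C¹` maps `u k`: uniform sup and Hölder bounds
  obtain ⟨C₁, hC₁, hH⟩ := morrey_holder (volume : Measure E) (F := F) hq1 hp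
  obtain ⟨C₂, hC₂, hS⟩ := morrey_sup (volume : Measure E) (F := F) hq1 hp
  have hMtop : C₂ * (Nf + Ng) < ⊤ := ENNReal.mul_lt_top hC₂ (ENNReal.add_lt_top.2 ⟨hNf, hNg⟩)
  have hA : C₁ * Ng ≠ ⊤ := (ENNReal.mul_lt_top hC₁ hNg).ne
  set Ch : ℝ≥0 := (C₁ * Ng).toNNReal with hCh
  have hChc : (Ch : ℝ≥0∞) = C₁ * Ng := ENNReal.coe_toNNReal hA
  have hSk : ∀ k x, ‖u k x‖ₑ ≤ C₂ * (Nf + Ng) := fun k x =>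
    (hS (hu1 k) x).trans (by gcongr; exacts [hu0 k, hDu' k])
  have hHk : ∀ k, HolderWith Ch r (u k) := fun k x y => by
    rw [edist_eq_enorm_sub, hChc, hrγ]
    exact (hH (hu1 k) x y).trans (by gcongr; exact hDu' k)
  -- a.e. convergence `u k → f`; the convergence set is dense
  have hae : ∀ᵐ x ∂volume, Tendsto (fun k => u k x) atTop (𝓝 (f x)) :=
    ae_tendsto_normed_convolution hφ0 hφ2 hf_li
  have hdense : Dense {x | Tendsto (fun k => u k x) atTop (𝓝 (f x))} := Measure.dense_of_ae hae
  -- `(u k x)ₖ` is Cauchy for every `x`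
  have hcauchy : ∀ x, CauchySeq fun k => u k x := by
    intro x
    refine Metric.cauchySeq_iff.2 fun ε hε => ?_
    have hε3 : 0 < ε / 3 := by positivity
    have hmod : Tendsto (fun t : ℝ => (Ch : ℝ) * t ^ (r : ℝ)) (𝓝 0) (𝓝 0) := by
      have h1 : Tendsto (fun t : ℝ => t ^ (r : ℝ)) (𝓝 0) (𝓝 0) := by
        have := (Real.continuousAt_rpow_const 0 (r : ℝ) (Or.inr hr0.le)).tendsto
        simpa [Real.zero_rpow hr0.ne'] using this
      simpa using h1.const_mul (Ch : ℝ)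
    obtain ⟨δ, hδ, hδε⟩ := Metric.eventually_nhds_iff.1 (hmod.eventually (gt_mem_nhds hε3))
    obtain ⟨s, hs, hxs⟩ := hdense.exists_dist_lt x hδ
    have hxs' : (Ch : ℝ) * dist x s ^ (r : ℝ) < ε / 3 := by
      apply hδε
      simpa [Real.dist_eq, abs_of_nonneg dist_nonneg] using hxs
    obtain ⟨N, hN⟩ := Metric.cauchySeq_iff.1 hs.cauchySeq (ε / 3) hε3
    refine ⟨N, fun m hm k hk => ?_⟩
    have h1 : dist (u m x) (u m s) < ε / 3 := ((hHk m).dist_le x s).trans_lt hxs'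
    have h3 : dist (u k s) (u k x) < ε / 3 := by
      rw [dist_comm]; exact ((hHk k).dist_le x s).trans_lt hxs'
    calc dist (u m x) (u k x)
        ≤ dist (u m x) (u m s) + dist (u m s) (u k s) + dist (u k s) (u k x) :=
          dist_triangle4 _ _ _ _
      _ < ε / 3 + ε / 3 + ε / 3 := add_lt_add (add_lt_add h1 (hN m hm k hk)) h3
      _ = ε := by ring
  -- the everywhere-defined limit `G` is the sought version of `f`
  set G : E → F := fun x => limUnder atTop fun k => u k x with hG
  have hGt : ∀ x, Tendsto (fun k => u k x) atTop (𝓝 (G x)) := fun x =>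
    (hcauchy x).tendsto_limUnder
  refine ⟨G, ?_, ?_⟩
  · filter_upwards [hae] with x hx using tendsto_nhds_unique (hGt x) hx
  · have hGsup : ∀ x, ‖G x‖ₑ ≤ C₂ * (Nf + Ng) := fun x =>
      le_of_tendsto' ((continuous_enorm.tendsto _).comp (hGt x)) fun k => hSk k x
    have hGH : HolderWith Ch r G := fun x y =>
      le_of_tendsto' ((hGt x).edist (hGt y)) fun k => hHk k x y
    exact ENNReal.add_lt_top.2
      ⟨(iSup_le hGsup).trans_lt hMtop, hGH.eHolderNorm_le.trans_lt ENNReal.coe_lt_top⟩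

/-- **Discharge of `Literature.Analysis.FunctionSpaces.morrey_embedding`** (Evans, *PDE*, 2nd ed., §5.6.2, Theorems 4–5:
`W^{1,p}(ℝⁿ) ⊂ C^{0,1-n/p}(ℝⁿ)` for `n < p < ∞`, in the sense of a version `u* = u` a.e.; Adams,
*Sobolev Spaces* (1975), Thm. 5.4 Cases C, C'). A general additive Haar measure is a positive
finite multiple of Lebesgue measure (`Measure.isAddLeftInvariant_eq_smul`) and is absolutely
continuous with respect to it, so the statement reduces to
`exists_memBoundedHolder_of_memSobolevDomain`. [cite: Evans2010, §5.6.2 Theorems 4–5] -/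
theorem morrey_embedding_holds : morrey_embedding (E' := E) (F := F) := by
  intro p hp hp' μ _ f hf
  -- `volume = c • μ` with `c < ∞`, and `μ ≪ volume`
  have hc : (volume : Measure E) =
      ((Measure.addHaarScalarFactor (volume : Measure E) μ : ℝ≥0) : ℝ≥0∞) • μ :=
    Measure.isAddLeftInvariant_eq_smul (volume : Measure E) μ
  have hf' : MemSobolevDomain 1 p ⊤ (volume : Measure E) f := by
    rw [hc]; exact hf.smul_measure ENNReal.coe_ne_top
  obtain ⟨g, hg, hgH⟩ := exists_memBoundedHolder_of_memSobolevDomain hp hp' hf'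
  exact ⟨g, (Measure.absolutelyContinuous_isAddHaarMeasure μ volume).ae_eq hg, hgH⟩

end Literature.Analysis.FunctionSpaces
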